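import Summits.HodgeConjecture.CorCM.SexticOcticSlotReflexStabilizer
import Summits.HodgeConjecture.CorCM.ReflexSlotIncidence
import HarnessLib

/-!
# A sextic slot against an octic slot, VII: a common constituent is a SHARED SIGN CHARACTER or exhibits a REFLEX
# EMBEDDING

COR-CM (cell `pub-hodgecm2`, binder seat `b16` gen 47, count-neutral claim CM34-COMPLETE, file F7 — the abstract
theorem of the (3,4) cell; theorems only, no definition, no named fact, no `sorry`).  `G` acts transitively on `X`
(`|X| = 6`) and on `Y` (`|Y| = 8`), commuting with a fixed-point-free involution `ρ` (CM types `Φ ⊆ X`, `Ψ ⊆ Y` for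
`ρ`).  A COMMON CONSTITUENT of the two slots — in the concrete sense of
`CMTypeRankCommonConstituent.map_slotExt_antiSpan_le_of_pairwise`: a non-zero `G`-stable space `P` of `ρ`-odd weights
on `X` and a linear `T : ℚ^X → ℚ^Y`, equivariant and injective on `P`, with odd values — forces one of:

* (SHARED SIGN CHARACTER) non-zero odd weights `f` on `X`, `f'` on `Y` and `χ : G → ℚ` with `f∘g = χ(g)f`,
  `f'∘g = χ(g)f'` for all `g` — on CM fields: a shared imaginary quadratic subfield
  (`CorCM/SharedSignCharacterQuadraticSubfield`);
* (REFLEX EMBEDDING) for EVERY CM type `Φ'` of `X` a point `y ∈ Y` whose fixer is the stabiliser of `Φ'`: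
  `g y = y ⟺ gΦ' = Φ'` — on CM fields: `K_F` is the reflex field of `(K_T, Φ')` (`Fix(ψ₀) = Stab(Φ_T)`, the hypothesis
  of `CorCM/PairFlipSexticTimesReflexOcticHodge`).

**Theorem** `shared_eigen_or_reflex` (and `shared_eigen_or_reflex'` for a constituent carried from `Y` to `X`, reduced to
the first by a left inverse, `exists_inverse_constituent`).  PROOF (F1–F6): an element `g` of order `3` on `X ⊔ Y`
(F1); if `g` fixes `X` or `Y` pointwise the constituent is a line (F3) — a shared eigenvector (F2); otherwise `g` cycles
the pairs of `X` and fixes one pair of `Y`, `dim P ≠ 2` (F4), a line again gives a shared eigenvector, and `dim P = 3`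
makes the fixed point a reflex embedding for the orbit type (F5, F6), transported to every CM type by counting: the
`8` points of `Y` inject into the `8` CM types of `X` (`exists_translate_eq_of_reflex`).

## References

* [Shimura1998] G. Shimura, *Abelian Varieties with Complex Multiplication and Modular Functions*, §8.3 Prop. 28.
* [Dodson1984] B. Dodson, *The structure of Galois groups of CM-fields*, Trans. AMS 283 (1984), §1.1, §5.1.1–§5.1.2.
* [Serre1977] J.-P. Serre, *Linear Representations of Finite Groups*, GTM 42, §2.2, §2.6.
-/

noncomputable section

namespace Summit.HodgeConjecture.CorCM.SexticOctic

open Literature.NumberTheory.ComplexMultiplication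

variable {G : Type*} [Group G] {X Y : Type*} [MulAction G X] [MulAction G Y] {ρ : G}

/-! ## §1 The orbit type and its type vector -/

/-- **The type vector of the orbit type `Φ₊ = {x₀, cx₀, c²x₀}` is the orbit vector** `(1, 1, 1, −1, −1, −1)`.
[cite: Dodson1984, §5.1.2] -/
theorem antiVec_orbitType_frame {e : Fin 6 → X} (he : Function.Injective e) (i : Fin 6) :
    antiVec ({e 0, e 1, e 2} : Set X) (1 : G) (e i) = ![1, 1, 1, -1, -1, -1] i := by
  classical
  fin_cases i <;>
    norm_num [antiVec, translateInd, one_smul, Set.mem_insert_iff, Set.mem_singleton_iff, he.eq_iff, Fin.ext_iff]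

/-- **`a∘g = a ⟺ g` stabilises the type** (for the type vector `a = 2·𝟙_Φ − 1`). [cite: Dodson1987, §1.1 (p. 50)] -/
theorem antiVec_one_comp_eq_iff (Φ : Set X) (g : G) :
    (fun x => antiVec Φ (1 : G) (g • x)) = antiVec Φ (1 : G) ↔ ∀ x, g • x ∈ Φ ↔ x ∈ Φ := by
  classical
  constructor
  · intro h x
    have hx := congrFun h x
    simp only [antiVec, translateInd, one_smul] at hx
    by_cases h1 : g • x ∈ Φ <;> by_cases h2 : x ∈ Φ
    · simp [h1, h2]
    · norm_num [h1, h2] at hx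
    · norm_num [h1, h2] at hx
    · simp [h1, h2]
  · intro h
    funext x
    simp only [antiVec, translateInd, one_smul, h x]

/-! ## §2 All CM types are translates: transport of the reflex point -/

/-- **Counting: if `y₀ ∈ Y` (`|Y| = 8`, `G` transitive) has the stabiliser of a CM type `Φ₀` on `X` (`|X| = 6`), then
EVERY CM type of `X` is a translate `hΦ₀`** — the eight points of `Y` give eight distinct translates, and `X` carries only
`2³ = 8` CM types (one point from each of the three pairs of a frame). [cite: Dodson1984, §1.1 (Reflex Degree Theorem)] -/
theorem exists_translate_eq_of_reflex [Fintype Y] {e : Fin 6 → X} (hsurj : Function.Surjective e)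
    (hρe : ∀ i, ρ • e i = e (![3, 4, 5, 0, 1, 2] i)) (hY : Fintype.card Y = 8) [MulAction.IsPretransitive G Y]
    {Φ₀ : Set X} (hΦ₀ : IsCMTypeWith ρ Φ₀) {y₀ : Y} (hst : ∀ g : G, g • y₀ = y₀ ↔ ∀ x : X, g • x ∈ Φ₀ ↔ x ∈ Φ₀)
    {Φ' : Set X} (hΦ' : IsCMTypeWith ρ Φ') : ∃ h : G, ∀ x, x ∈ Φ' ↔ h⁻¹ • x ∈ Φ₀ := by
  classical
  have hYt : ∀ y : Y, ∃ g : G, g • y₀ = y := fun y => MulAction.exists_smul_eq G y₀ y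
  obtain ⟨Tm, hTm, hTmi, hTm₀⟩ := ReflexSlot.exists_typeMap hst hYt
  -- the code of a CM type: membership of `e 0, e 1, e 2`
  let κ : Set X → (Fin 3 → Bool) := fun Φ j => decide (e (![0, 1, 2] j) ∈ Φ)
  have hκ : ∀ {Φ₁ Φ₂ : Set X}, IsCMTypeWith ρ Φ₁ → IsCMTypeWith ρ Φ₂ → κ Φ₁ = κ Φ₂ → Φ₁ = Φ₂ := by
    intro Φ₁ Φ₂ h₁ h₂ h12
    have hj : ∀ j : Fin 3, e (![0, 1, 2] j) ∈ Φ₁ ↔ e (![0, 1, 2] j) ∈ Φ₂ := fun j => by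
      have := congrFun h12 j
      simpa [κ] using this
    have h0 : e 0 ∈ Φ₁ ↔ e 0 ∈ Φ₂ := by simpa using hj 0
    have h1 : e 1 ∈ Φ₁ ↔ e 1 ∈ Φ₂ := by simpa using hj 1
    have h2 : e 2 ∈ Φ₁ ↔ e 2 ∈ Φ₂ := by simpa using hj 2
    have h3 : e 3 ∈ Φ₁ ↔ e 3 ∈ Φ₂ := by
      rw [show e 3 = ρ • e 0 from (hρe 0).symm, h₁.rho_smul_mem_iff, h₂.rho_smul_mem_iff, h0]
    have h4 : e 4 ∈ Φ₁ ↔ e 4 ∈ Φ₂ := by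
      rw [show e 4 = ρ • e 1 from (hρe 1).symm, h₁.rho_smul_mem_iff, h₂.rho_smul_mem_iff, h1]
    have h5 : e 5 ∈ Φ₁ ↔ e 5 ∈ Φ₂ := by
      rw [show e 5 = ρ • e 2 from (hρe 2).symm, h₁.rho_smul_mem_iff, h₂.rho_smul_mem_iff, h2]
    have hall : ∀ i : Fin 6, e i ∈ Φ₁ ↔ e i ∈ Φ₂ := by
      intro i
      fin_cases i
      · exact h0
      · exact h1
      · exact h2
      · exact h3
      · exact h4
      · exact h5
    ext x
    obtain ⟨i, rfl⟩ := hsurj x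
    exact hall i
  -- `κ ∘ Tm : Y → (Fin 3 → Bool)` is injective between sets of size `8`, hence surjective
  have hinj : Function.Injective (κ ∘ Tm) := fun y y' hyy' =>
    hTmi (hκ (ReflexSlot.isCMTypeWith_typeMap hΦ₀ hTm hTm₀ hYt y)
      (ReflexSlot.isCMTypeWith_typeMap hΦ₀ hTm hTm₀ hYt y') hyy')
  have hsurjκ : Function.Surjective (κ ∘ Tm) :=
    (Finite.injective_iff_surjective_of_equiv
      (Fintype.equivOfCardEq (by rw [hY]; simp) : Y ≃ (Fin 3 → Bool))).1 hinj
  obtain ⟨y, hy⟩ := hsurjκ (κ Φ')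
  have hΦ'y : Φ' = Tm y := (hκ hΦ' (ReflexSlot.isCMTypeWith_typeMap hΦ₀ hTm hTm₀ hYt y) hy.symm)
  obtain ⟨h, rfl⟩ := hYt y
  refine ⟨h, fun x => ?_⟩
  rw [hΦ'y, hTm, hTm₀]

/-- **Transport of the reflex point**: if `Fix(y₀) = Stab(Φ₀)` and `Φ' = hΦ₀`, then `Fix(h y₀) = Stab(Φ')`; so with
`exists_translate_eq_of_reflex` EVERY CM type of `X` has a reflex point in `Y`. [cite: Shimura1998, §8.3 Prop. 28] -/
theorem forall_exists_reflex_of_reflex [Fintype Y] {e : Fin 6 → X} (hsurj : Function.Surjective e)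
    (hρe : ∀ i, ρ • e i = e (![3, 4, 5, 0, 1, 2] i)) (hY : Fintype.card Y = 8) [MulAction.IsPretransitive G Y]
    {Φ₀ : Set X} (hΦ₀ : IsCMTypeWith ρ Φ₀) {y₀ : Y} (hst : ∀ g : G, g • y₀ = y₀ ↔ ∀ x : X, g • x ∈ Φ₀ ↔ x ∈ Φ₀)
    {Φ' : Set X} (hΦ' : IsCMTypeWith ρ Φ') : ∃ y : Y, ∀ g : G, g • y = y ↔ ∀ x : X, g • x ∈ Φ' ↔ x ∈ Φ' := by
  obtain ⟨h, hh⟩ := exists_translate_eq_of_reflex hsurj hρe hY hΦ₀ hst hΦ'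
  refine ⟨h • y₀, fun g => ?_⟩
  have e1 : g • h • y₀ = h • y₀ ↔ (h⁻¹ * g * h) • y₀ = y₀ := by
    rw [mul_smul, mul_smul, inv_smul_eq_iff]
  rw [e1, hst]
  constructor
  · intro H x
    have := H (h⁻¹ • x)
    rw [mul_smul, mul_smul, smul_inv_smul, ← hh, ← hh] at this
    exact this
  · intro H x
    have := H (h • x)
    rw [hh, hh, ← mul_smul h⁻¹ g, ← mul_smul, inv_smul_smul] at this
    exact this

/-! ## §3 A constituent carried from `Y` to `X` gives one carried from `X` to `Y` -/

/-- **Reversing a common constituent.**  From a non-zero `G`-stable `Q ≤ ℚ^Y` and `S : ℚ^Y → ℚ^X` equivariant and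
injective on `Q`, the image `P = S(Q)` is non-zero and `G`-stable, and a left inverse `T` of `S|_Q` is equivariant and
injective on `P` with values in `Q`. [cite: Serre1977, §2.2] -/
theorem exists_inverse_constituent {Q : Submodule ℚ (Y → ℚ)} (hQ0 : Q ≠ ⊥)
    (hQst : ∀ g : G, ∀ f ∈ Q, (fun y => f (g • y)) ∈ Q) (S : (Y → ℚ) →ₗ[ℚ] (X → ℚ))
    (hS : ∀ g : G, ∀ f ∈ Q, S (fun y => f (g • y)) = fun x => S f (g • x)) (hSinj : ∀ f ∈ Q, S f = 0 → f = 0) :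
    ∃ T : (X → ℚ) →ₗ[ℚ] (Y → ℚ), Q.map S ≠ ⊥ ∧ (∀ g : G, ∀ f ∈ Q.map S, (fun x => f (g • x)) ∈ Q.map S) ∧
      (∀ g : G, ∀ f ∈ Q.map S, T (fun x => f (g • x)) = fun y => T f (g • y)) ∧ (∀ f ∈ Q.map S, T f ∈ Q) ∧
      ∀ f ∈ Q.map S, T f = 0 → f = 0 := by
  have hinj : Function.Injective (S.domRestrict Q) := by
    rw [← LinearMap.ker_eq_bot, LinearMap.ker_eq_bot']
    intro q hq
    exact Subtype.ext (hSinj q q.2 hq)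
  obtain ⟨L, hL⟩ := LinearMap.exists_leftInverse_of_injective (S.domRestrict Q) (LinearMap.ker_eq_bot.2 hinj)
  have hLS : ∀ q : Q, L (S q) = q := fun q => by
    have := LinearMap.congr_fun hL q
    simpa using this
  refine ⟨Q.subtype ∘ₗ L, ?_, ?_, ?_, ?_, ?_⟩
  · obtain ⟨q, hq, hq0⟩ := (Submodule.ne_bot_iff Q).1 hQ0
    exact (Submodule.ne_bot_iff _).2 ⟨S q, ⟨q, hq, rfl⟩, fun h => hq0 (hSinj q hq h)⟩
  · rintro g _ ⟨q, hq, rfl⟩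
    exact ⟨_, hQst g q hq, hS g q hq⟩
  · rintro g _ ⟨q, hq, rfl⟩
    rw [← hS g q hq]
    simp only [LinearMap.coe_comp, Function.comp_apply, Submodule.coe_subtype]
    rw [hLS ⟨_, hQst g q hq⟩, hLS ⟨q, hq⟩]
  · rintro _ ⟨q, hq, rfl⟩
    simp only [LinearMap.coe_comp, Function.comp_apply, Submodule.coe_subtype]
    exact (L (S q)).2
  · rintro _ ⟨q, hq, rfl⟩ h0
    simp only [LinearMap.coe_comp, Function.comp_apply, Submodule.coe_subtype] at h0
    rw [hLS ⟨q, hq⟩] at h0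
    simp only at h0
    rw [h0, map_zero]

/-! ## §4 The theorem of the (3,4) cell -/

/-- **A common constituent of a sextic slot and an octic slot is a shared sign character or exhibits a reflex
embedding.**  See the module docstring; `P ≤ Anti(X)` non-zero and `G`-stable, `T` equivariant and injective on `P`
with odd values on `Y`. [cite: Shimura1998, §8.3 Prop. 28] [cite: Dodson1984, §5.1.1–§5.1.2] [cite: Serre1977, §2.6] -/
theorem shared_eigen_or_reflex [Fintype X] [Fintype Y] [DecidableEq X] [DecidableEq Y]
    [MulAction.IsPretransitive G X] [MulAction.IsPretransitive G Y] {Φ : Set X} (hΦ : IsCMTypeWith ρ Φ)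
    {Ψ : Set Y} (hΨ : IsCMTypeWith ρ Ψ) (hX : Fintype.card X = 6) (hY : Fintype.card Y = 8)
    {P : Submodule ℚ (X → ℚ)} (hPanti : P ≤ antiWeights (E := X) ρ) (hP0 : P ≠ ⊥)
    (hPst : ∀ g : G, ∀ f ∈ P, (fun x => f (g • x)) ∈ P) (T : (X → ℚ) →ₗ[ℚ] (Y → ℚ))
    (hT : ∀ g : G, ∀ f ∈ P, T (fun x => f (g • x)) = fun y => T f (g • y))
    (hTanti : ∀ f ∈ P, T f ∈ antiWeights (E := Y) ρ) (hTinj : ∀ f ∈ P, T f = 0 → f = 0) :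
    (∃ (χ : G → ℚ) (f : X → ℚ) (f' : Y → ℚ), f ∈ antiWeights (E := X) ρ ∧ f' ∈ antiWeights (E := Y) ρ ∧ f ≠ 0 ∧
        f' ≠ 0 ∧ (∀ g : G, (fun x => f (g • x)) = χ g • f) ∧ ∀ g : G, (fun y => f' (g • y)) = χ g • f') ∨
      ∀ Φ' : Set X, IsCMTypeWith ρ Φ' → ∃ y : Y, ∀ g : G, g • y = y ↔ ∀ x : X, g • x ∈ Φ' ↔ x ∈ Φ' := by
  have hfin : 0 < Module.finrank ℚ P := by
    rw [pos_iff_ne_zero, Ne, Submodule.finrank_eq_zero]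
    exact hP0
  -- a line carries a shared eigenvector
  have hline : Module.finrank ℚ P ≤ 1 → (∃ (χ : G → ℚ) (f : X → ℚ) (f' : Y → ℚ), f ∈ antiWeights (E := X) ρ ∧
      f' ∈ antiWeights (E := Y) ρ ∧ f ≠ 0 ∧ f' ≠ 0 ∧ (∀ g : G, (fun x => f (g • x)) = χ g • f) ∧
      ∀ g : G, (fun y => f' (g • y)) = χ g • f') := fun h1 => by
    obtain ⟨χ, f, hfP, hf0, hTf0, hf, hf'⟩ := exists_shared_eigen_of_finrank_eq_one (by omega) hPst T hT hTinj
    exact ⟨χ, f, T f, hPanti hfP, hTanti f hfP, hf0, hTf0, hf, hf'⟩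
  obtain ⟨g, hg3X, hg3Y, hmove⟩ := exists_cube_eq_one (G := G) (X := X) (Y := Y) hX
  by_cases hX' : ∃ x₀ : X, g • x₀ ≠ x₀
  · obtain ⟨x₀, hx₀⟩ := hX'
    obtain ⟨he, hsurj, hρe, hce⟩ := frameX_index hΦ hX hg3X hx₀
    by_cases hY' : ∃ y₁ : Y, g • y₁ ≠ y₁
    · obtain ⟨y₁, hy₁⟩ := hY'
      obtain ⟨y₀, hy₀⟩ := exists_smul_eq_self_of_cube hY hg3Y
      obtain ⟨he', hsurj', hρe', hce'⟩ := frameY_index hΨ hY hg3Y hy₀ hy₁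
      have h2 := finrank_ne_two hsurj hρe hce hsurj' hce' hPanti hPst T hT hTinj
      have hle3 : Module.finrank ℚ P ≤ 3 :=
        (Submodule.finrank_mono hPanti).trans (finrank_antiWeights_le_three hsurj hρe)
      by_cases h3 : Module.finrank ℚ P = 3
      · right
        have hPeq := eq_antiWeights_of_finrank_eq_three hsurj hρe hPanti h3
        have ha : ∀ i, antiVec ({x₀, g • x₀, g • g • x₀} : Set X) (1 : G)
            (![x₀, g • x₀, g • g • x₀, ρ • x₀, ρ • g • x₀, ρ • g • g • x₀] i) = ![1, 1, 1, -1, -1, -1] i :=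
          antiVec_orbitType_frame (G := G) he
        have haP : antiVec ({x₀, g • x₀, g • g • x₀} : Set X) (1 : G) ∈ P := by
          rw [hPeq]; exact orbitVec_mem_antiWeights hsurj hρe ha
        have hst : ∀ k : G, k • y₀ = y₀ ↔
            ∀ x : X, k • x ∈ ({x₀, g • x₀, g • g • x₀} : Set X) ↔ x ∈ ({x₀, g • x₀, g • g • x₀} : Set X) :=
          fun k => (smul_eq_iff_orbitVec_comp_eq hsurj hρe hce he' hsurj' hρe' hce' hΨ.comm hPanti hPst hT hTanti
            hTinj h3 ha haP k).trans (antiVec_one_comp_eq_iff _ k)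
        have hΦp : IsCMTypeWith ρ ({x₀, g • x₀, g • g • x₀} : Set X) :=
          isCMTypeWith_orbitType hΦ hg3X hx₀ (frameX_cases hΦ hX hg3X hx₀)
        intro Φ' hΦ'
        exact forall_exists_reflex_of_reflex hsurj hρe hY hΦp hst hΦ'
      · exact Or.inl (hline (by omega))
    · push Not at hY'
      exact Or.inl (hline (finrank_le_one_of_fixing_octic hsurj hρe hce hY' hPanti hPst T hT hTinj))
  · push Not at hX'
    obtain ⟨y₁, hy₁⟩ := hmove.resolve_left (by push Not; exact hX')
    obtain ⟨y₀, hy₀⟩ := exists_smul_eq_self_of_cube hY hg3Y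
    obtain ⟨he', hsurj', hρe', hce'⟩ := frameY_index hΨ hY hg3Y hy₀ hy₁
    exact Or.inl (hline (finrank_le_one_of_fixing_sextic he' hsurj' hρe' hΨ.comm hce' hX' hPst T hT hTanti hTinj))

/-- **The same for a common constituent carried from the octic slot to the sextic one** (`Q ≤ Anti(Y)`,
`S : ℚ^Y → ℚ^X`), reduced to `shared_eigen_or_reflex` by `exists_inverse_constituent`. [cite: Serre1977, §2.2] -/
theorem shared_eigen_or_reflex' [Fintype X] [Fintype Y] [DecidableEq X] [DecidableEq Y]
    [MulAction.IsPretransitive G X] [MulAction.IsPretransitive G Y] {Φ : Set X} (hΦ : IsCMTypeWith ρ Φ)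
    {Ψ : Set Y} (hΨ : IsCMTypeWith ρ Ψ) (hX : Fintype.card X = 6) (hY : Fintype.card Y = 8)
    {Q : Submodule ℚ (Y → ℚ)} (hQanti : Q ≤ antiWeights (E := Y) ρ) (hQ0 : Q ≠ ⊥)
    (hQst : ∀ g : G, ∀ f ∈ Q, (fun y => f (g • y)) ∈ Q) (S : (Y → ℚ) →ₗ[ℚ] (X → ℚ))
    (hS : ∀ g : G, ∀ f ∈ Q, S (fun y => f (g • y)) = fun x => S f (g • x))
    (hSanti : ∀ f ∈ Q, S f ∈ antiWeights (E := X) ρ) (hSinj : ∀ f ∈ Q, S f = 0 → f = 0) :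
    (∃ (χ : G → ℚ) (f : X → ℚ) (f' : Y → ℚ), f ∈ antiWeights (E := X) ρ ∧ f' ∈ antiWeights (E := Y) ρ ∧ f ≠ 0 ∧
        f' ≠ 0 ∧ (∀ g : G, (fun x => f (g • x)) = χ g • f) ∧ ∀ g : G, (fun y => f' (g • y)) = χ g • f') ∨
      ∀ Φ' : Set X, IsCMTypeWith ρ Φ' → ∃ y : Y, ∀ g : G, g • y = y ↔ ∀ x : X, g • x ∈ Φ' ↔ x ∈ Φ' := by
  obtain ⟨T, hP0, hPst, hT, hTQ, hTinj⟩ := exists_inverse_constituent hQ0 hQst S hS hSinj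
  have hPanti : Q.map S ≤ antiWeights (E := X) ρ := by
    rintro _ ⟨q, hq, rfl⟩
    exact hSanti q hq
  exact shared_eigen_or_reflex hΦ hΨ hX hY hPanti hP0 hPst T hT (fun f hf => hQanti (hTQ f hf)) hTinj

end Summit.HodgeConjecture.CorCM.SexticOctic

end
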